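import Literature.Geometry.Symplectic.PencilEndMemberSphere
import Literature.Geometry.Symplectic.PencilEndFarFrame
import Literature.Topology.FourManifolds.SmoothEmbeddingCriteria
import HarnessLib

/-!
# Coordinates for the leaves of the blown-up end: the lift through `inP` and the box chart

Support file (no new facts, D-0026) for the glue
`jPlanePencil_localFamily_homotopySphere ⟸ hls_localFoliation_embeddedSphere_trivialNormal`
(C. Wendl, *Holomorphic Curves in Low Dimensions* (2018), proof of Prop. 2.53, p. 65: the members
of the pencil near `u₀` are READ OFF from the leaves of the local foliation of the blown-up
end-compactification `Y = (M ∖ p) ∪ Ω` by embedded `JY`-spheres near the compactified member).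

To read a leaf `S_a ⊆ Y` as a map into `M ∖ p` and to locate its point on the exceptional disc we
need two coordinate devices on `Y = G.Y` (`G : PencilEnd p`, `PencilEndGluing.lean`):

* §1 the LEFT INVERSE `G.inPInv : G.Y → M ∖ p` of the open embedding `G.inP`, smooth on
  `range G.inP`, with the transfer lemmas: a map `Φ` into `range inP` is `C^∞` iff its lift
  `inPInv ∘ Φ` is, the lift has the same differential (`mfderiv inP = id` in the glued charts), and
  a `JY`-holomorphic curve lifts to a `J`-holomorphic curve (`JY ∘ inP = J`);
* §2 the BOX CHART `G.boxCoord : G.Y → ℂ × ℂ`, `y ↦ (x', w)`, the extended chart at the centre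
  `inB (0, b₀)` of the exceptional disc read through `flatCx`, a diffeomorphism
  `range inB ≅ box` inverse to `G.inBox`, with the identities of differentials
  `D boxCoord ∘ D inBox = id`, `D inBox ∘ D boxCoord = id`;
* §3 HOLOMORPHY IN THE BOX CHART: `JY` read in the box chart is the constant `i`
  (`inTangentCoordinates_JY_inB`), so the box coordinates of a `JY`-holomorphic curve with values
  in `range inB` are complex differentiable (`differentiableAt_boxCoord_comp`).

## References

* C. Wendl, *Holomorphic Curves in Low Dimensions*, LNM 2216 (2018), proof of Prop. 2.53. [Wendl2018]
-/

noncomputable section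

open scoped Manifold ContDiff Topology
open Set Function Filter Metric Complex Literature.Topology.FourManifolds

namespace Literature.Geometry.Symplectic

namespace PencilEnd

variable {M : Type*} [TopologicalSpace M] [ChartedSpace (EuclideanSpace ℝ (Fin 4)) M] [T2Space M]
  [IsManifold (𝓡 4) ∞ M] {p : M} (G : PencilEnd p)

/-! ### §1 The left inverse of `inP` and the transfer lemmas -/

/-- **The left inverse of the open embedding `inP : M ∖ p → Y`** (junk off `range inP`).
[folklore] -/
def inPInv : G.Y → punctured p :=
  @invFun _ _ ⟨G.glueInv ⟨_, G.half_mem_box⟩⟩ G.inP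

/-- `inP` is injective. [folklore] -/
theorem injective_inP : Injective G.inP :=
  G.glueData.inl_injective

/-- `inPInv (inP x) = x`. [folklore] -/
@[simp] theorem inPInv_inP (x : punctured p) : G.inPInv (G.inP x) = x :=
  @leftInverse_invFun _ _ ⟨G.glueInv ⟨_, G.half_mem_box⟩⟩ _ G.injective_inP x

/-- `inP (inPInv y) = y` on `range inP`. [folklore] -/
theorem inP_inPInv {y : G.Y} (hy : y ∈ range G.inP) : G.inP (G.inPInv y) = y :=
  @invFun_eq _ _ ⟨G.glueInv ⟨_, G.half_mem_box⟩⟩ _ _ hy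

/-- `range inP` is open. [folklore] -/
theorem isOpen_range_inP : IsOpen (range G.inP) :=
  G.glueData.isOpen_range_inl

/-- `inP` is `C^∞`. [folklore] -/
theorem contMDiff_inP : ContMDiff (𝓡 4) (𝓡 4) ∞ G.inP :=
  G.glueData.contMDiff_inl

/-- **`inPInv` is `C^∞` on `range inP`.** [folklore] -/
theorem contMDiffOn_inPInv : ContMDiffOn (𝓡 4) (𝓡 4) ∞ G.inPInv (range G.inP) :=
  contMDiffOn_leftInverse_of_isImmersion G.glueData.isSmoothEmbedding_inl.isImmersion
    G.glueData.isSmoothEmbedding_inl.isEmbedding G.inPInv_inP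

section Transfer

variable {N : Type*} [NormedAddCommGroup N] [NormedSpace ℝ N]

/-- **Differential of a map through `inP`**: `D(inP ∘ f)(x) = Df(x)` (the glued charts at `inP a`
are the charts at `a`). [folklore] -/
theorem hasMFDerivAt_inP_comp {f : N → punctured p} {x : N}
    {f' : TangentSpace 𝓘(ℝ, N) x →L[ℝ] TangentSpace (𝓡 4) (f x)} (hf : HasMFDerivAt 𝓘(ℝ, N) (𝓡 4) f x f') :
    HasMFDerivAt 𝓘(ℝ, N) (𝓡 4) (G.inP ∘ f) x f' := by
  exact ((G.hasMFDerivAt_inP (f x)).comp x hf).congr_mfderiv (ContinuousLinearMap.ext fun _ => rfl)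

/-- `mfderiv (inP ∘ f) x = mfderiv f x` at points of differentiability. [folklore] -/
theorem mfderiv_inP_comp {f : N → punctured p} {x : N} (hf : MDifferentiableAt 𝓘(ℝ, N) (𝓡 4) f x) :
    mfderiv 𝓘(ℝ, N) (𝓡 4) (G.inP ∘ f) x = mfderiv 𝓘(ℝ, N) (𝓡 4) f x :=
  (G.hasMFDerivAt_inP_comp hf.hasMFDerivAt).mfderiv

/-- **Smoothness of the lift**: a map into `range inP`, `C^∞` on `s`, has `C^∞` lift `inPInv ∘ Φ`.
[folklore] -/
theorem contMDiffOn_inPInv_comp {Φ : N → G.Y} {s : Set N} (hΦ : ContMDiffOn 𝓘(ℝ, N) (𝓡 4) ∞ Φ s)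
    (hr : MapsTo Φ s (range G.inP)) : ContMDiffOn 𝓘(ℝ, N) (𝓡 4) ∞ (G.inPInv ∘ Φ) s :=
  G.contMDiffOn_inPInv.comp hΦ hr

omit [NormedSpace ℝ N] in
/-- Near a point mapped into `range inP` (open), `Φ = inP ∘ (inPInv ∘ Φ)`. [folklore] -/
theorem eventuallyEq_inP_inPInv_comp {Φ : N → G.Y} {x : N} (hΦ : ContinuousAt Φ x)
    (hx : Φ x ∈ range G.inP) : (G.inP ∘ (G.inPInv ∘ Φ)) =ᶠ[𝓝 x] Φ := by
  filter_upwards [hΦ.preimage_mem_nhds (G.isOpen_range_inP.mem_nhds hx)] with z hz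
  exact G.inP_inPInv hz

/-- **Differential of the lift**: `D(inPInv ∘ Φ)(x) = DΦ(x)` when `Φ` is differentiable at `x`
with `Φ x ∈ range inP` and the lift is differentiable at `x`. [folklore] -/
theorem mfderiv_inPInv_comp {Φ : N → G.Y} {x : N} (hΦ : MDifferentiableAt 𝓘(ℝ, N) (𝓡 4) Φ x)
    (hx : Φ x ∈ range G.inP) (hL : MDifferentiableAt 𝓘(ℝ, N) (𝓡 4) (G.inPInv ∘ Φ) x) :
    mfderiv 𝓘(ℝ, N) (𝓡 4) (G.inPInv ∘ Φ) x = mfderiv 𝓘(ℝ, N) (𝓡 4) Φ x := by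
  have h1 : HasMFDerivAt 𝓘(ℝ, N) (𝓡 4) (G.inP ∘ (G.inPInv ∘ Φ)) x
      (mfderiv 𝓘(ℝ, N) (𝓡 4) (G.inPInv ∘ Φ) x) := G.hasMFDerivAt_inP_comp hL.hasMFDerivAt
  have h2 : HasMFDerivAt 𝓘(ℝ, N) (𝓡 4) Φ x (mfderiv 𝓘(ℝ, N) (𝓡 4) (G.inPInv ∘ Φ) x) :=
    h1.congr_of_eventuallyEq (G.eventuallyEq_inP_inPInv_comp hΦ.continuousAt hx).symm
  exact h2.mfderiv.symm

end Transfer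

/-- **A `JY`-holomorphic curve through `inP` is `J`-holomorphic** (`JY (inP x) = J x` and
`D(inP ∘ f) = Df`). [cite: Wendl2018, proof of Prop. 2.53 (p. 65)] -/
theorem isJHolomorphic_of_inP_comp (J : ∀ x : punctured p, TangentSpace (𝓡 4) x →L[ℝ] TangentSpace (𝓡 4) x)
    {f : ℂ → punctured p} (hf : ∀ z, MDifferentiableAt 𝓘(ℝ, ℂ) (𝓡 4) f z)
    (h : IsJHolomorphic (𝓡 4) (fun y => G.JY J y) (G.inP ∘ f)) : IsJHolomorphic (𝓡 4) J f := by
  intro z ζ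
  have h1 := h z ζ
  rw [G.mfderiv_inP_comp (hf z)] at h1
  refine h1.trans ?_
  change G.JY J (G.inP (f z)) _ = _
  rw [G.JY_inP]
  rfl

/-- **A `J`-holomorphic curve maps to a `JY`-holomorphic curve under `inP`.** [folklore] -/
theorem isJHolomorphic_inP_comp (J : ∀ x : punctured p, TangentSpace (𝓡 4) x →L[ℝ] TangentSpace (𝓡 4) x)
    {f : ℂ → punctured p} (hf : ∀ z, MDifferentiableAt 𝓘(ℝ, ℂ) (𝓡 4) f z)
    (h : IsJHolomorphic (𝓡 4) J f) : IsJHolomorphic (𝓡 4) (fun y => G.JY J y) (G.inP ∘ f) := by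
  intro z ζ
  rw [G.mfderiv_inP_comp (hf z)]
  refine (h z ζ).trans ?_
  change _ = G.JY J (G.inP (f z)) _
  rw [G.JY_inP]
  rfl

/-! ### §2 The box chart -/

/-- The centre `(0, b₀)` of the exceptional disc, as a point of the box. [folklore] -/
def ctr : G.box :=
  ⟨((0 : ℂ), G.b₀), G.zero_mem_box⟩

omit [T2Space M] [IsManifold (𝓡 4) ∞ M] in
/-- `ctr = (0, b₀)`. [folklore] -/
@[simp] theorem coe_ctr : (G.ctr : ℂ × ℂ) = ((0 : ℂ), G.b₀) := rfl

omit [T2Space M] [IsManifold (𝓡 4) ∞ M] in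
/-- The centre lies on the exceptional disc. [folklore] -/
theorem ctr_fst : (G.ctr : ℂ × ℂ).1 = 0 := rfl

/-- **The box chart** `y ↦ (x', w)`: the extended chart of `Y` at the centre of the exceptional disc,
read through `flatCx` (meaningful on `range inB`, junk elsewhere). [cite: Wendl2018, proof of Prop. 2.53 (p. 65)] -/
def boxCoord (y : G.Y) : ℂ × ℂ :=
  flatCx (extChartAt (𝓡 4) (G.inB G.ctr) y)

/-- `boxCoord (inB b) = b`. [folklore] -/
@[simp] theorem boxCoord_inB (b : G.box) : G.boxCoord (G.inB b) = (b : ℂ × ℂ) := by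
  rw [boxCoord, G.extChartAt_inB_apply_inB G.ctr_fst, ContinuousLinearEquiv.apply_symm_apply]

/-- `boxCoord (inBox q) = q` on the box. [folklore] -/
theorem boxCoord_inBox {q : ℂ × ℂ} (hq : q ∈ G.box) : G.boxCoord (G.inBox q) = q := by
  rw [G.inBox_of_mem hq, boxCoord_inB]

/-- `range inB` is open. [folklore] -/
theorem isOpen_range_inB : IsOpen (range G.inB) :=
  G.glueData.isOpen_range_inr

/-- `inBox (boxCoord y) = y` on `range inB`. [folklore] -/
theorem inBox_boxCoord {y : G.Y} (hy : y ∈ range G.inB) : G.inBox (G.boxCoord y) = y := by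
  obtain ⟨b, rfl⟩ := hy
  rw [boxCoord_inB, G.inBox_of_mem b.2]

/-- `boxCoord y ∈ box` on `range inB`. [folklore] -/
theorem boxCoord_mem_box {y : G.Y} (hy : y ∈ range G.inB) : G.boxCoord y ∈ G.box := by
  obtain ⟨b, rfl⟩ := hy
  rw [boxCoord_inB]; exact b.2

/-- `inBox q ∈ range inB`. [folklore] -/
theorem inBox_mem_range (q : ℂ × ℂ) : G.inBox q ∈ range G.inB := ⟨_, rfl⟩

/-- A point of `Y` off `range inP` lies on the exceptional disc: `y = inB b` with `b.1 = 0`.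
[folklore] -/
theorem exists_eq_inB_of_notMem_range_inP {y : G.Y} (hy : y ∉ range G.inP) :
    ∃ b : G.box, (b : ℂ × ℂ).1 = 0 ∧ G.inB b = y := by
  rcases G.glueData.exists_inl_or_inr y with ⟨a, rfl⟩ | ⟨b, rfl⟩
  · exact absurd ⟨a, rfl⟩ hy
  · refine ⟨b, ?_, rfl⟩
    by_contra hb
    exact hy ⟨G.glueInv b, G.inP_eq_inB_iff.2 ⟨G.glueInv_mem_src hb, G.glueFun_glueInv hb⟩⟩

/-- A point of `range inB` with nonzero `x'`-coordinate lies in `range inP`. [folklore] -/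
theorem mem_range_inP_of_boxCoord_fst_ne_zero {y : G.Y} (hy : y ∈ range G.inB)
    (h : (G.boxCoord y).1 ≠ 0) : y ∈ range G.inP := by
  obtain ⟨b, rfl⟩ := hy
  rw [boxCoord_inB] at h
  exact ⟨G.glueInv b, G.inP_eq_inB_iff.2 ⟨G.glueInv_mem_src h, G.glueFun_glueInv h⟩⟩

/-- A point of `range inB ∩ range inP` has nonzero `x'`-coordinate. [folklore] -/
theorem boxCoord_fst_ne_zero_of_mem_range_inP {y : G.Y} (hy : y ∈ range G.inB)
    (h : y ∈ range G.inP) : (G.boxCoord y).1 ≠ 0 := by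
  obtain ⟨b, rfl⟩ := hy
  rw [boxCoord_inB]
  intro hb
  exact G.inB_notMem_range_inP hb h

/-- **The box chart is `C^∞` on `range inB`.** [folklore] -/
theorem contMDiffOn_boxCoord : ContMDiffOn (𝓡 4) 𝓘(ℝ, ℂ × ℂ) ∞ G.boxCoord (range G.inB) := by
  have h1 : ContMDiffOn (𝓡 4) 𝓘(ℝ, EuclideanSpace ℝ (Fin 4)) ∞ (extChartAt (𝓡 4) (G.inB G.ctr))
      (range G.inB) := by
    rw [← G.extChartAt_inB_source G.ctr_fst, extChartAt_source]
    exact contMDiffOn_extChartAt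
  exact (flatCx.contDiff.contMDiff.comp_contMDiffOn h1 :)

section BoxPt

variable {N : Type*} [NormedAddCommGroup N] [NormedSpace ℝ N] {g : N → ℂ × ℂ} {x : N}

omit [T2Space M] [IsManifold (𝓡 4) ∞ M] in
/-- Differential of a box-valued map from the Fréchet derivative of its coordinates (general flat
parameter space). [folklore] -/
theorem hasMFDerivAt_boxPt_comp' {g' : N →L[ℝ] ℂ × ℂ} (hg : HasFDerivAt g g' x) (hx : g x ∈ G.box) :
    HasMFDerivAt 𝓘(ℝ, N) 𝓘(ℝ, ℂ × ℂ) (fun y => G.boxPt (g y)) x g' := by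
  have hcont : ContinuousAt (fun y => G.boxPt (g y)) x := by
    rw [Topology.IsInducing.subtypeVal.continuousAt_iff]
    refine hg.continuousAt.congr ?_
    filter_upwards [hg.continuousAt.preimage_mem_nhds (G.box.isOpen.mem_nhds hx)] with y hy
    exact (G.coe_boxPt_of_mem hy).symm
  refine ⟨hcont, ?_⟩
  have hev : writtenInExtChartAt 𝓘(ℝ, N) 𝓘(ℝ, ℂ × ℂ) x (fun y => G.boxPt (g y)) =ᶠ[𝓝 x] g := by
    filter_upwards [hg.continuousAt.preimage_mem_nhds (G.box.isOpen.mem_nhds hx)] with y hy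
    simp only [writtenInExtChartAt, extChartAt_box_apply, comp_apply, extChartAt_model_space_eq_id,
      PartialEquiv.refl_coe, PartialEquiv.refl_symm, id]
    exact G.coe_boxPt_of_mem hy
  have h0 : extChartAt 𝓘(ℝ, N) x x = x := rfl
  rw [h0]
  exact (hg.congr_of_eventuallyEq hev).hasFDerivWithinAt

omit [T2Space M] [IsManifold (𝓡 4) ∞ M] in
/-- Smoothness of a box-valued map from smoothness of its coordinates (general flat parameter
space). [folklore] -/
theorem contMDiffOn_boxPt_comp' {s : Set N} (hg : ContDiffOn ℝ ∞ g s) (hmaps : MapsTo g s G.box) :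
    ContMDiffOn 𝓘(ℝ, N) 𝓘(ℝ, ℂ × ℂ) ∞ (fun y => G.boxPt (g y)) s := by
  intro y hy
  rw [← ContMDiffWithinAt.subtypeVal_comp_iff]
  refine (hg.contMDiffOn y hy).congr (fun y' hy' => ?_) ?_
  · exact G.coe_boxPt_of_mem (hmaps hy')
  · exact G.coe_boxPt_of_mem (hmaps hy)

/-- Smoothness of `inBox ∘ g` from smoothness of the coordinates (general flat parameter space).
[folklore] -/
theorem contMDiffOn_inBox_comp' {s : Set N} (hg : ContDiffOn ℝ ∞ g s) (hmaps : MapsTo g s G.box) :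
    ContMDiffOn 𝓘(ℝ, N) (𝓡 4) ∞ (fun y => G.inBox (g y)) s :=
  G.glueData.contMDiff_inr.comp_contMDiffOn (G.contMDiffOn_boxPt_comp' hg hmaps)

/-- Differential of `inBox ∘ g` at a point sent to the exceptional disc (general flat parameter
space): `flatCx⁻¹ ∘ g'`. [folklore] -/
theorem hasMFDerivAt_inBox_comp' {g' : N →L[ℝ] ℂ × ℂ} (hg : HasFDerivAt g g' x) (hx : g x ∈ G.box)
    (h0 : (g x).1 = 0) :
    HasMFDerivAt 𝓘(ℝ, N) (𝓡 4) (fun y => G.inBox (g y)) x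
      ((flatCx.symm : ℂ × ℂ →L[ℝ] EuclideanSpace ℝ (Fin 4)).comp g') := by
  have h1 := G.hasMFDerivAt_boxPt_comp' hg hx
  have h2 : HasMFDerivAt 𝓘(ℝ, ℂ × ℂ) (𝓡 4) G.inB (G.boxPt (g x))
      (flatCx.symm : ℂ × ℂ →L[ℝ] EuclideanSpace ℝ (Fin 4)) :=
    G.hasMFDerivAt_inB (by rw [G.coe_boxPt_of_mem hx]; exact h0)
  exact h2.comp x h1

end BoxPt


/-- **`inBox` is `C^∞` on the box.** [folklore] -/
theorem contMDiffOn_inBox : ContMDiffOn 𝓘(ℝ, ℂ × ℂ) (𝓡 4) ∞ G.inBox G.box :=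
  G.contMDiffOn_inBox_comp' (g := fun q : ℂ × ℂ => q) contDiff_id.contDiffOn fun _ hq => hq

/-- **`D boxCoord ∘ D inBox = id` on the box.** [folklore] -/
theorem mfderiv_boxCoord_comp_mfderiv_inBox {q : ℂ × ℂ} (hq : q ∈ G.box) :
    (mfderiv (𝓡 4) 𝓘(ℝ, ℂ × ℂ) G.boxCoord (G.inBox q)).comp
      (mfderiv 𝓘(ℝ, ℂ × ℂ) (𝓡 4) G.inBox q) = ContinuousLinearMap.id ℝ (ℂ × ℂ) := by
  have hn : (∞ : WithTop ℕ∞) ≠ 0 := by simp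
  have hI : MDifferentiableAt 𝓘(ℝ, ℂ × ℂ) (𝓡 4) G.inBox q :=
    (G.contMDiffOn_inBox.contMDiffAt (G.box.isOpen.mem_nhds hq)).mdifferentiableAt hn
  have hC : MDifferentiableAt (𝓡 4) 𝓘(ℝ, ℂ × ℂ) G.boxCoord (G.inBox q) :=
    (G.contMDiffOn_boxCoord.contMDiffAt (G.isOpen_range_inB.mem_nhds (G.inBox_mem_range q))).mdifferentiableAt hn
  have hcomp : HasMFDerivAt 𝓘(ℝ, ℂ × ℂ) 𝓘(ℝ, ℂ × ℂ) (G.boxCoord ∘ G.inBox) q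
      ((mfderiv (𝓡 4) 𝓘(ℝ, ℂ × ℂ) G.boxCoord (G.inBox q)).comp
        (mfderiv 𝓘(ℝ, ℂ × ℂ) (𝓡 4) G.inBox q)) := hC.hasMFDerivAt.comp q hI.hasMFDerivAt
  have hid : HasMFDerivAt 𝓘(ℝ, ℂ × ℂ) 𝓘(ℝ, ℂ × ℂ) (G.boxCoord ∘ G.inBox) q
      (ContinuousLinearMap.id ℝ (ℂ × ℂ)) := by
    refine (hasMFDerivAt_id (I := 𝓘(ℝ, ℂ × ℂ)) q).congr_of_eventuallyEq ?_
    filter_upwards [G.box.isOpen.mem_nhds hq] with z hz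
    exact G.boxCoord_inBox hz
  exact hcomp.mfderiv.symm.trans hid.mfderiv

/-- **`D inBox ∘ D boxCoord = id` on `range inB`.** [folklore] -/
theorem mfderiv_inBox_comp_mfderiv_boxCoord {y : G.Y} (hy : y ∈ range G.inB) :
    (mfderiv 𝓘(ℝ, ℂ × ℂ) (𝓡 4) G.inBox (G.boxCoord y)).comp
      (mfderiv (𝓡 4) 𝓘(ℝ, ℂ × ℂ) G.boxCoord y) =
      ContinuousLinearMap.id ℝ (TangentSpace (𝓡 4) y) := by
  have hn : (∞ : WithTop ℕ∞) ≠ 0 := by simp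
  have hI : MDifferentiableAt 𝓘(ℝ, ℂ × ℂ) (𝓡 4) G.inBox (G.boxCoord y) :=
    (G.contMDiffOn_inBox.contMDiffAt (G.box.isOpen.mem_nhds (G.boxCoord_mem_box hy))).mdifferentiableAt hn
  have hC : MDifferentiableAt (𝓡 4) 𝓘(ℝ, ℂ × ℂ) G.boxCoord y :=
    (G.contMDiffOn_boxCoord.contMDiffAt (G.isOpen_range_inB.mem_nhds hy)).mdifferentiableAt hn
  have hcomp : HasMFDerivAt (𝓡 4) (𝓡 4) (G.inBox ∘ G.boxCoord) y
      ((mfderiv 𝓘(ℝ, ℂ × ℂ) (𝓡 4) G.inBox (G.boxCoord y)).comp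
        (mfderiv (𝓡 4) 𝓘(ℝ, ℂ × ℂ) G.boxCoord y)) := hI.hasMFDerivAt.comp y hC.hasMFDerivAt
  have hid : HasMFDerivAt (𝓡 4) (𝓡 4) (G.inBox ∘ G.boxCoord) y
      (ContinuousLinearMap.id ℝ (TangentSpace (𝓡 4) y)) := by
    refine (hasMFDerivAt_id (I := 𝓡 4) y).congr_of_eventuallyEq ?_
    filter_upwards [G.isOpen_range_inB.mem_nhds hy] with z hz
    exact G.inBox_boxCoord hz
  exact hcomp.mfderiv.symm.trans hid.mfderiv

/-- **The differential of the box chart is injective on `range inB`.** [folklore] -/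
theorem injective_mfderiv_boxCoord {y : G.Y} (hy : y ∈ range G.inB) :
    Injective (mfderiv (𝓡 4) 𝓘(ℝ, ℂ × ℂ) G.boxCoord y) := by
  intro v₁ v₂ h
  have h' := congrArg (mfderiv 𝓘(ℝ, ℂ × ℂ) (𝓡 4) G.inBox (G.boxCoord y)) h
  have e := G.mfderiv_inBox_comp_mfderiv_boxCoord hy
  have e1 := ContinuousLinearMap.ext_iff.1 e v₁
  have e2 := ContinuousLinearMap.ext_iff.1 e v₂
  simp only [ContinuousLinearMap.comp_apply] at e1 e2
  exact (e1.symm.trans h').trans e2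

/-- **The differential of `inBox` is injective on the box.** [folklore] -/
theorem injective_mfderiv_inBox {q : ℂ × ℂ} (hq : q ∈ G.box) :
    Injective (mfderiv 𝓘(ℝ, ℂ × ℂ) (𝓡 4) G.inBox q) := by
  intro v₁ v₂ h
  have h' := congrArg (mfderiv (𝓡 4) 𝓘(ℝ, ℂ × ℂ) G.boxCoord (G.inBox q)) h
  have e := G.mfderiv_boxCoord_comp_mfderiv_inBox hq
  have e1 := ContinuousLinearMap.ext_iff.1 e v₁
  have e2 := ContinuousLinearMap.ext_iff.1 e v₂
  simp only [ContinuousLinearMap.comp_apply] at e1 e2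
  exact (e1.symm.trans h').trans e2

/-! ### §3 Holomorphy in the box chart -/

/-- **In the box chart `JY` is `i`**: for `y = inB b`,
`τ_{y → inB ctr}(y) (JY y v) = flatI (τ_{y → inB ctr}(y) v)`. [cite: Wendl2018, proof of Prop. 2.53 (p. 65)] -/
theorem tangentCoordChange_JY_inB
    (J : ∀ x : punctured p, TangentSpace (𝓡 4) x →L[ℝ] TangentSpace (𝓡 4) x)
    (hJstd : ∀ x : punctured p, InPuncturedChartBall p G.rad x →
      ∀ (v : TangentSpace (𝓡 4) x) (c : EuclideanSpace ℝ (Fin 4)),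
        inner ℝ (fderiv ℝ inversion (extChartAt (𝓡 4) p x.1 - extChartAt (𝓡 4) p p)
          (mfderiv (𝓡 4) 𝓘(ℝ, EuclideanSpace ℝ (Fin 4))
            (fun z : punctured p => extChartAt (𝓡 4) p z.1) x (J x v))) c
        = stdSymplecticForm (fderiv ℝ inversion (extChartAt (𝓡 4) p x.1 - extChartAt (𝓡 4) p p)
          (mfderiv (𝓡 4) 𝓘(ℝ, EuclideanSpace ℝ (Fin 4))
            (fun z : punctured p => extChartAt (𝓡 4) p z.1) x v)) c)
    (b : G.box) (v : EuclideanSpace ℝ (Fin 4)) :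
    tangentCoordChange (𝓡 4) (G.inB b) (G.inB G.ctr) (G.inB b) (G.JY J (G.inB b) v) =
      flatI (tangentCoordChange (𝓡 4) (G.inB b) (G.inB G.ctr) (G.inB b) v) := by
  have key := G.inTangentCoordinates_JY_inB J G.ctr_fst hJstd b
  have hsrc : G.inB b ∈ (chartAt (EuclideanSpace ℝ (Fin 4)) (G.inB G.ctr)).source := by
    rw [← extChartAt_source (𝓡 4), G.extChartAt_inB_source G.ctr_fst]; exact ⟨b, rfl⟩
  have hsrc' : G.inB b ∈ (extChartAt (𝓡 4) (G.inB G.ctr)).source := by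
    rw [extChartAt_source]; exact hsrc
  rw [inTangentCoordinates_eq (id : G.Y → G.Y) id (fun y => G.JY J y) (x₀ := G.inB G.ctr)
    (x := G.inB b) hsrc hsrc] at key
  set u := tangentCoordChange (𝓡 4) (G.inB b) (G.inB G.ctr) (G.inB b) v with hu
  have hback : tangentCoordChange (𝓡 4) (G.inB G.ctr) (G.inB b) (G.inB b) u = v := by
    rw [hu, tangentCoordChange_comp (w := G.inB b) (x := G.inB G.ctr) (y := G.inB b) (z := G.inB b)
      ⟨⟨mem_extChartAt_source (G.inB b), hsrc'⟩, mem_extChartAt_source (G.inB b)⟩]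
    exact tangentCoordChange_self (mem_extChartAt_source (G.inB b))
  have h := ContinuousLinearMap.ext_iff.1 key u
  simp only [ContinuousLinearMap.comp_apply] at h
  change tangentCoordChange (𝓡 4) (G.inB b) (G.inB G.ctr) (G.inB b)
    (G.JY J (G.inB b) (tangentCoordChange (𝓡 4) (G.inB G.ctr) (G.inB b) (G.inB b) u)) = flatI u at h
  rwa [hback] at h

/-- **Box coordinates of a `JY`-holomorphic curve are complex differentiable** at points mapped
into `range inB`. [cite: Wendl2018, proof of Prop. 2.53 (p. 65)] -/
theorem differentiableAt_boxCoord_comp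
    (J : ∀ x : punctured p, TangentSpace (𝓡 4) x →L[ℝ] TangentSpace (𝓡 4) x)
    (hJstd : ∀ x : punctured p, InPuncturedChartBall p G.rad x →
      ∀ (v : TangentSpace (𝓡 4) x) (c : EuclideanSpace ℝ (Fin 4)),
        inner ℝ (fderiv ℝ inversion (extChartAt (𝓡 4) p x.1 - extChartAt (𝓡 4) p p)
          (mfderiv (𝓡 4) 𝓘(ℝ, EuclideanSpace ℝ (Fin 4))
            (fun z : punctured p => extChartAt (𝓡 4) p z.1) x (J x v))) c
        = stdSymplecticForm (fderiv ℝ inversion (extChartAt (𝓡 4) p x.1 - extChartAt (𝓡 4) p p)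
          (mfderiv (𝓡 4) 𝓘(ℝ, EuclideanSpace ℝ (Fin 4))
            (fun z : punctured p => extChartAt (𝓡 4) p z.1) x v)) c)
    {γ : ℂ → G.Y} {w : ℂ} (hγ : MDifferentiableAt 𝓘(ℝ, ℂ) (𝓡 4) γ w)
    (hJ : ∀ ζ : ℂ, mfderiv 𝓘(ℝ, ℂ) (𝓡 4) γ w (Complex.I * ζ : ℂ) =
      G.JY J (γ w) (mfderiv 𝓘(ℝ, ℂ) (𝓡 4) γ w ζ))
    (hw : γ w ∈ range G.inB) : DifferentiableAt ℂ (G.boxCoord ∘ γ) w := by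
  obtain ⟨b, hb⟩ := hw
  have hsrc : γ w ∈ (chartAt (EuclideanSpace ℝ (Fin 4)) (G.inB G.ctr)).source := by
    rw [← extChartAt_source (𝓡 4), G.extChartAt_inB_source G.ctr_fst]; exact ⟨b, hb⟩
  set τ : EuclideanSpace ℝ (Fin 4) →L[ℝ] EuclideanSpace ℝ (Fin 4) :=
    tangentCoordChange (𝓡 4) (γ w) (G.inB G.ctr) (γ w) with hτ
  set L : ℂ →L[ℝ] EuclideanSpace ℝ (Fin 4) := mfderiv 𝓘(ℝ, ℂ) (𝓡 4) γ w with hL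
  have hγ' : HasMFDerivAt 𝓘(ℝ, ℂ) (𝓡 4) γ w L := hγ.hasMFDerivAt
  have he : HasMFDerivAt (𝓡 4) 𝓘(ℝ, EuclideanSpace ℝ (Fin 4)) (extChartAt (𝓡 4) (G.inB G.ctr)) (γ w) τ :=
    hasMFDerivAt_extChartAt_tangentCoordChange hsrc
  have h1 : HasMFDerivAt 𝓘(ℝ, ℂ) 𝓘(ℝ, EuclideanSpace ℝ (Fin 4))
      (extChartAt (𝓡 4) (G.inB G.ctr) ∘ γ) w (τ.comp L) := he.comp w hγ'
  have h2 : HasFDerivAt (extChartAt (𝓡 4) (G.inB G.ctr) ∘ γ)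
      (τ.comp L : ℂ →L[ℝ] EuclideanSpace ℝ (Fin 4)) w := hasMFDerivAt_iff_hasFDerivAt.1 h1
  set D : ℂ →L[ℝ] ℂ × ℂ := (flatCx : EuclideanSpace ℝ (Fin 4) →L[ℝ] ℂ × ℂ).comp (τ.comp L) with hD
  have h3 : HasFDerivAt (G.boxCoord ∘ γ) D w := flatCx.hasFDerivAt.comp w h2
  rw [differentiableAt_iff_restrictScalars ℝ h3.differentiableAt]
  refine exists_restrictScalars_eq_of_map_mul_I (fderiv ℝ (G.boxCoord ∘ γ) w) fun ζ => ?_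
  have h4 : fderiv ℝ (G.boxCoord ∘ γ) w = D := h3.fderiv
  rw [h4, hD]
  simp only [ContinuousLinearMap.comp_apply, ContinuousLinearEquiv.coe_coe]
  have hJζ : L (Complex.I * ζ) = G.JY J (γ w) (L ζ) := hJ ζ
  rw [hJζ, ← flatCx_flatI]
  congr 1
  rw [hτ, ← hb]
  exact G.tangentCoordChange_JY_inB J hJstd b _

/-- **Box coordinates of a `JY`-holomorphic curve are holomorphic** on an open set mapped into
`range inB`. [cite: Wendl2018, proof of Prop. 2.53 (p. 65)] -/
theorem differentiableOn_boxCoord_comp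
    (J : ∀ x : punctured p, TangentSpace (𝓡 4) x →L[ℝ] TangentSpace (𝓡 4) x)
    (hJstd : ∀ x : punctured p, InPuncturedChartBall p G.rad x →
      ∀ (v : TangentSpace (𝓡 4) x) (c : EuclideanSpace ℝ (Fin 4)),
        inner ℝ (fderiv ℝ inversion (extChartAt (𝓡 4) p x.1 - extChartAt (𝓡 4) p p)
          (mfderiv (𝓡 4) 𝓘(ℝ, EuclideanSpace ℝ (Fin 4))
            (fun z : punctured p => extChartAt (𝓡 4) p z.1) x (J x v))) c
        = stdSymplecticForm (fderiv ℝ inversion (extChartAt (𝓡 4) p x.1 - extChartAt (𝓡 4) p p)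
          (mfderiv (𝓡 4) 𝓘(ℝ, EuclideanSpace ℝ (Fin 4))
            (fun z : punctured p => extChartAt (𝓡 4) p z.1) x v)) c)
    {γ : ℂ → G.Y} {s : Set ℂ} (hs : IsOpen s) (hγ : ContMDiffOn 𝓘(ℝ, ℂ) (𝓡 4) ∞ γ s)
    (hJ : IsJHolomorphic (𝓡 4) (fun y => G.JY J y) γ) (hmaps : MapsTo γ s (range G.inB)) :
    DifferentiableOn ℂ (G.boxCoord ∘ γ) s := by
  intro w hw
  have hn : (∞ : WithTop ℕ∞) ≠ 0 := by simp
  have hd : MDifferentiableAt 𝓘(ℝ, ℂ) (𝓡 4) γ w :=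
    (hγ.contMDiffAt (hs.mem_nhds hw)).mdifferentiableAt hn
  exact (G.differentiableAt_boxCoord_comp J hJstd hd (hJ w) (hmaps hw)).differentiableWithinAt

end PencilEnd

end Literature.Geometry.Symplectic
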